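import Mathlib
import HarnessLib
import Summits.Ventures.LatticeQCDFlow.Scoring.BatchMeansConsistencyEnvelope
import Summits.Ventures.LatticeQCDFlow.Scoring.BatchMeansVarianceInvBatches
import Summits.Ventures.LatticeQCDFlow.Scoring.GeometricEnvelopeBlockSumSharp
import Summits.Ventures.LatticeQCDFlow.Scoring.DoeblinPowerGeometricEnvelope

/-!
# THE MEAN-SQUARE ERROR OF THE BATCH-MEANS ESTIMATOR IS `O(1/a + 1/b²)` from any start, under a
# geometric sup-norm envelope / a Doeblin power — the `N^{−2/3}` rate at `a ∼ N^{2/3}` batches of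
# length `b ∼ N^{1/3}`

HONEST FRAMING: exact (Metropolis-corrected) sampling algorithms for lattice gauge theory;
figures of merit are autocorrelation/cost numbers at stated couplings and volumes; no
continuum-physics claim.

Venture `LatticeQCDFlow` (cell pub-lqcd), topic `Scoring`; FANOUT row 8 (`s0-cpn-nemc`, GEN-20).
NEW WORK of the cell, not a published result; no definition is introduced; nothing is cited as a
fact.  `Scoring/BatchMeansConsistencyEnvelope.lean` gave `E[(σ̂²_{a,b} − σ²_f)²] ≤ K/a + K'/b`, the
`1/b` coming from the `O(√b)` bias bound of the squared batch sum.  With the SHARP bias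
`|E_{μ₀}[S_j²] − b σ²_f| ≤ K_b` uniformly (`Scoring/GeometricEnvelopeBlockSumSharp.lean`,
`K_b = 32 C² A (A+1)/(1−ρ)²`) the bias of `V = (1/a) Σ_j S_j²/b` is `≤ K_b/b`, its square `≤ K_b²/b²`;
and the variance of `V` is `O(1/a)` INCLUDING the covariance sum (which is `O(1/(ab))`:
`Scoring/BatchMeansVarianceInvBatches.lean`, the `1/a` form of
`Scoring/BatchMeansVarianceEnvelope.lean`).  Hence, by GEN-19's decomposition
`σ̂² = (a/(a−1))(V − W)` re-run verbatim: `E_{μ₀}[(σ̂²_{a,b} − σ²_f)²] ≤ K/a + K''/b²` for every initial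
law, `a ≥ 2`, `b ≥ 1`.  READING: for a run of length `N = ab` the bound is `K b/N + K''/b²`, minimised
at `b ∼ N^{1/3}` where it is `O(N^{−2/3})` — the mean-square rate of non-overlapping batch means
(printed counterpart NAMED ONLY: Chien–Goldsman–Melamed 1997; Flegal–Jones 2010 Thm 2: MSE-optimal
batch length `∝ N^{1/3}`); only the upper bound is typed here.  The Doeblin-power corollary
(`(nHit κ m)(x, ·) ≥ ε ν`) is `chain_batchMeans_sigmaHat_mse_le_rate_of_nHit`.

## Content (envelope `(A, ρ)` with `0 ≤ A`, `0 ≤ ρ < 1`, `π` invariant, `|f| ≤ C` measurable;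
## `P_{μ₀}` the chain's path law from ANY `μ₀`; `SE²_BM = replicaSEsq` of the `a` batch means of length `b`)

* **`chain_batchMeans_sigmaHat_mse_le_rate_of_envelope`** — `∃ K K'', ∀ μ₀, ∀ a ≥ 2, ∀ b ≥ 1,
  E_{μ₀}[(ab · SE²_BM − σ²_f)²] ≤ K/a + K''/b²` (`K = 32 K₄ + 16 K₆ + 16 θ⁴`, `K'' = 16 K_b²`);
* **`chain_batchMeans_sigmaHat_mse_le_rate_of_nHit`** — the same under `(nHit κ m)(x, ·) ≥ ε ν`
  (`0 < ε ≤ 1`, `0 < m`).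

NOT CLAIMED: the matching lower bound / the exact leading constants (so "optimal" is not claimed, only
the `N^{−2/3}` upper rate); overlapping batch means; unbounded observables.
-/

noncomputable section

namespace Summit.Ventures.LatticeQCDFlow.Scoring

open MeasureTheory ProbabilityTheory Filter Finset Preorder Literature.Probability.MarkovChains
open scoped ENNReal Topology

variable {Ω : Type*} [MeasurableSpace Ω]

section Envelope

variable {κ : Kernel Ω Ω} [IsMarkovKernel κ] {π : Measure Ω} [IsProbabilityMeasure π] {A ρ : ℝ}

/-- **THE MEAN-SQUARE ERROR OF THE BATCH-MEANS ESTIMATOR IS `O(1/a + 1/b²)`, FROM ANY START.**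
`π` invariant, envelope `|(kop κ)^[t] g − πg| ≤ 2 C_g A ρ^t` (`0 ≤ A`, `0 ≤ ρ < 1`), `|f| ≤ C`
measurable.  There are constants `K, K''` (depending on `C`, `A`, `ρ` only) such that for EVERY initial
law `μ₀`, every `a ≥ 2` and every `b ≥ 1`: `E_{μ₀}[(ab · SE²_BM − σ²_f)²] ≤ K/a + K''/b²`. -/
theorem chain_batchMeans_sigmaHat_mse_le_rate_of_envelope (hπ : Kernel.Invariant κ π)
    (henv : ∀ (g : Ω → ℝ), Measurable g → ∀ (Cg : ℝ), (∀ x, |g x| ≤ Cg) →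
      ∀ (t : ℕ) (x : Ω), |(kop κ)^[t] g x - ∫ y, g y ∂π| ≤ 2 * Cg * (A * ρ ^ t))
    (hA : 0 ≤ A) (hρ0 : 0 ≤ ρ) (hρ1 : ρ < 1)
    {f : Ω → ℝ} (hf : Measurable f) {C : ℝ} (hC : ∀ x, |f x| ≤ C) :
    ∃ K K'' : ℝ, ∀ (μ₀ : Measure Ω) [IsProbabilityMeasure μ₀] (a b : ℕ), 2 ≤ a → b ≠ 0 →
      ∫ x, (((b * a : ℕ) : ℝ)
          * replicaSEsq (fun j (x : ℕ → Ω) => (∑ i ∈ Finset.range b, f (x (b * j + i))) / b) a x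
          - ((∫ y, (f y - ∫ z, f z ∂π) ^ 2 ∂π)
            + 2 * ∑' k, ∫ y, (f y - ∫ z, f z ∂π)
              * (kop κ)^[k + 1] (fun y => f y - ∫ z, f z ∂π) y ∂π)) ^ 2
        ∂(Kernel.trajMeasure (X := fun _ : ℕ => Ω) μ₀
          (fun n : ℕ => κ.comap (fun h : (i : ↥(Finset.Iic n)) → Ω => h ⟨n, Finset.mem_Iic.2 le_rfl⟩)
            (measurable_pi_apply _)))
        ≤ K / a + K'' / (b : ℝ) ^ 2 := by
  have h1ρ : 0 < 1 - ρ := sub_pos.2 hρ1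
  have h1ρ' : 1 - ρ ≠ 0 := h1ρ.ne'
  set c := ∫ z, f z ∂π with hc
  set σ2 := (∫ y, (f y - c) ^ 2 ∂π)
      + 2 * ∑' k, ∫ y, (f y - c) * (kop κ)^[k + 1] (fun y => f y - c) y ∂π with hσ2
  set θ : ℝ := 4 * C * A / (1 - ρ) with hθ
  set K4 : ℝ := 512 * θ ^ 4 with hK4
  set K6 : ℝ := 8 * (2 * C) ^ 2 * A ^ 2 * ((1 + ρ) / (1 - ρ) ^ 2) * (10 * θ ^ 2) * ((1 + ρ) / (1 - ρ)) with hK6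
  set Kb : ℝ := 32 * C ^ 2 * A * (A + 1) / (1 - ρ) ^ 2 with hKb
  set σmax : ℝ := θ ^ 2 with hσmax
  have hσ0 : 0 ≤ σ2 := greenKubo_nonneg_of_envelope hπ henv hρ0 hρ1 hf hC
  have hσle : σ2 ≤ σmax := greenKubo_le_of_envelope hπ henv hρ0 hρ1 hf hC
  obtain ⟨hfb, hCfb, hfb0⟩ := centred_observable_bounds π hf hC
  have hC0 : 0 ≤ C := (abs_nonneg _).trans (hC (Classical.choice (nonempty_of_isProbabilityMeasure π)))
  refine ⟨32 * K4 + 16 * K6 + 16 * σmax ^ 2, 16 * Kb ^ 2, ?_⟩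
  intro μ₀ hμ₀ a b ha hb
  set P := Kernel.trajMeasure (X := fun _ : ℕ => Ω) μ₀
      (fun n : ℕ => κ.comap (fun h : (i : ↥(Finset.Iic n)) → Ω => h ⟨n, Finset.mem_Iic.2 le_rfl⟩)
        (measurable_pi_apply _)) with hP
  have ha0 : a ≠ 0 := by omega
  have ha2 : (2 : ℝ) ≤ a := by exact_mod_cast ha
  have haR : (0 : ℝ) < a := by linarith
  have hbR : (0 : ℝ) < b := Nat.cast_pos.2 (Nat.pos_of_ne_zero hb)
  have hb1 : (1 : ℝ) ≤ b := Nat.one_le_cast.2 (Nat.pos_of_ne_zero hb)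
  -- the pieces `U j`, `V`, `EV`, `W`
  set U : ℕ → (ℕ → Ω) → ℝ := fun j x =>
    (∑ i ∈ Finset.range b, (f (x (b * j + i)) - c)) ^ 2 / b with hU
  set EV : ℝ := (∑ j ∈ Finset.range a, ∫ y, U j y ∂P) / a with hEV
  set r : ℝ := (a : ℝ) / ((a : ℝ) - 1) with hr
  have ha1 : (0 : ℝ) < (a : ℝ) - 1 := by linarith only [ha2]
  have hr1 : 1 ≤ r := by rw [hr, le_div_iff₀ ha1]; linarith only [ha2]
  have hr2 : r ≤ 2 := by rw [hr, div_le_iff₀ ha1]; linarith only [ha2]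
  have hr4 : r ^ 2 ≤ 4 := by nlinarith only [hr1, hr2]
  have hr12 : (r - 1) ^ 2 ≤ 4 / (a : ℝ) ^ 2 := by
    have hr' : r - 1 = 1 / ((a : ℝ) - 1) := by
      rw [hr]; field_simp; ring
    rw [hr', div_pow, one_pow, div_le_div_iff₀ (pow_pos ha1 2) (pow_pos haR 2)]
    nlinarith only [ha2]
  -- (1) the variance of `V`
  have hVar := chain_batchSq_mean_variance_le_inv_batches_of_envelope henv hρ0 hρ1 hf hC μ₀ ha0 hb
  rw [← hP] at hVar
  -- (2) the bias of `V`: `|EV − σ²| ≤ K_b / b` (the SHARP second moment)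
  have hbias : |EV - σ2| ≤ Kb / b := by
    have hj : ∀ j, |∫ y, U j y ∂P - σ2| ≤ Kb / b := by
      intro j
      have h := abs_chain_blockSum_sq_sub_le_sharp_of_envelope μ₀ henv hA hρ0 hρ1 hf hC (b * j) b
      rw [← hP] at h
      have hUj : ∫ y, U j y ∂P = (∫ y, (∑ i ∈ Finset.range b, (f (y (b * j + i)) - c)) ^ 2 ∂P) / b :=
        integral_div _ _
      rw [hUj, show (∫ y, (∑ i ∈ Finset.range b, (f (y (b * j + i)) - c)) ^ 2 ∂P) / (b : ℝ) - σ2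
          = ((∫ y, (∑ i ∈ Finset.range b, (f (y (b * j + i)) - c)) ^ 2 ∂P) - b * σ2) / b by
            field_simp, abs_div, abs_of_pos hbR]
      exact div_le_div_of_nonneg_right h hbR.le
    have hsum : EV - σ2 = (∑ j ∈ Finset.range a, (∫ y, U j y ∂P - σ2)) / a := by
      rw [hEV, Finset.sum_sub_distrib, Finset.sum_const, Finset.card_range, nsmul_eq_mul]
      field_simp
    rw [hsum, abs_div, abs_of_pos haR, div_le_iff₀ haR]
    calc |∑ j ∈ Finset.range a, (∫ y, U j y ∂P - σ2)|
        ≤ ∑ j ∈ Finset.range a, |∫ y, U j y ∂P - σ2| := Finset.abs_sum_le_sum_abs _ _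
      _ ≤ ∑ j ∈ Finset.range a, Kb / b := Finset.sum_le_sum fun j _ => hj j
      _ = Kb / b * a := by rw [Finset.sum_const, Finset.card_range, nsmul_eq_mul]; ring
  have hbias2 : (EV - σ2) ^ 2 ≤ Kb ^ 2 / (b : ℝ) ^ 2 := by
    have h1 : (EV - σ2) ^ 2 ≤ (Kb / b) ^ 2 :=
      (sq_abs (EV - σ2)).symm.trans_le (pow_le_pow_left₀ (abs_nonneg _) hbias 2)
    rwa [div_pow] at h1
  -- (3) `E W² ≤ K₄/a²`
  have hT4 := chain_blockSum_fourth_le_of_envelope henv hρ0 hρ1 hf hC μ₀ 0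
    (Nat.mul_ne_zero hb ha0)
  rw [← hP] at hT4
  simp only [zero_add] at hT4
  have hW : ∫ x, ((∑ n ∈ Finset.range (b * a), (f (x n) - c)) ^ 2 / ((b : ℝ) * (a : ℝ) ^ 2)) ^ 2 ∂P
      ≤ K4 / (a : ℝ) ^ 2 := by
    have hpt : ∀ x : ℕ → Ω, ((∑ n ∈ Finset.range (b * a), (f (x n) - c)) ^ 2 / ((b : ℝ) * (a : ℝ) ^ 2)) ^ 2
        = (∑ n ∈ Finset.range (b * a), (f (x n) - c)) ^ 4 / (((b : ℝ) * (a : ℝ) ^ 2) ^ 2) := fun x => by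
      rw [div_pow, ← pow_mul]
    rw [integral_congr_ae (ae_of_all _ hpt), integral_div]
    calc (∫ x, (∑ n ∈ Finset.range (b * a), (f (x n) - c)) ^ 4 ∂P) / (((b : ℝ) * (a : ℝ) ^ 2) ^ 2)
        ≤ (512 * (4 * C * A / (1 - ρ)) ^ 4 * ((b * a : ℕ) : ℝ) ^ 2) / (((b : ℝ) * (a : ℝ) ^ 2) ^ 2) :=
          div_le_div_of_nonneg_right hT4 (by positivity)
      _ = K4 / (a : ℝ) ^ 2 := by
          rw [hK4, hθ]; push_cast; field_simp
  -- (4) pointwise decomposition and the elementary inequality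
  have hdecomp : ∀ x : ℕ → Ω,
      ((b * a : ℕ) : ℝ) * replicaSEsq (fun j (x : ℕ → Ω) =>
          (∑ i ∈ Finset.range b, f (x (b * j + i))) / b) a x - σ2
        = r * ((∑ j ∈ Finset.range a, U j x) / a - EV) + r * (EV - σ2)
          + (-(r * ((∑ n ∈ Finset.range (b * a), (f (x n) - c)) ^ 2 / ((b : ℝ) * (a : ℝ) ^ 2))))
          + (r - 1) * σ2 := fun x => by
    rw [batchMeans_sigmaHat_eq f c ha hb x]
    ring
  have hσ4 : σ2 ^ 2 ≤ σmax ^ 2 := pow_le_pow_left₀ hσ0 hσle 2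
  have h4sq : ∀ p q u v : ℝ, (p + q + u + v) ^ 2 ≤ 4 * (p ^ 2 + q ^ 2 + u ^ 2 + v ^ 2) :=
    fun p q u v => by
      nlinarith only [sq_nonneg (p - q), sq_nonneg (p - u), sq_nonneg (p - v), sq_nonneg (q - u),
        sq_nonneg (q - v), sq_nonneg (u - v)]
  have hv4 : (r - 1) ^ 2 * σ2 ^ 2 ≤ 4 / (a : ℝ) ^ 2 * σmax ^ 2 :=
    mul_le_mul hr12 hσ4 (sq_nonneg _) (by positivity)
  have hpt : ∀ x : ℕ → Ω,
      (((b * a : ℕ) : ℝ) * replicaSEsq (fun j (x : ℕ → Ω) =>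
          (∑ i ∈ Finset.range b, f (x (b * j + i))) / b) a x - σ2) ^ 2
        ≤ 16 * ((∑ j ∈ Finset.range a, U j x) / a - EV) ^ 2 + 16 * (EV - σ2) ^ 2
          + 16 * ((∑ n ∈ Finset.range (b * a), (f (x n) - c)) ^ 2 / ((b : ℝ) * (a : ℝ) ^ 2)) ^ 2
          + 16 / (a : ℝ) ^ 2 * σmax ^ 2 := by
    intro x
    have hX := mul_le_mul_of_nonneg_right hr4 (sq_nonneg ((∑ j ∈ Finset.range a, U j x) / a - EV))
    have hY := mul_le_mul_of_nonneg_right hr4 (sq_nonneg (EV - σ2))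
    have hZ := mul_le_mul_of_nonneg_right hr4
      (sq_nonneg ((∑ n ∈ Finset.range (b * a), (f (x n) - c)) ^ 2 / ((b : ℝ) * (a : ℝ) ^ 2)))
    rw [hdecomp x]
    calc (r * ((∑ j ∈ Finset.range a, U j x) / a - EV) + r * (EV - σ2)
          + (-(r * ((∑ n ∈ Finset.range (b * a), (f (x n) - c)) ^ 2 / ((b : ℝ) * (a : ℝ) ^ 2))))
          + (r - 1) * σ2) ^ 2
        ≤ 4 * ((r * ((∑ j ∈ Finset.range a, U j x) / a - EV)) ^ 2 + (r * (EV - σ2)) ^ 2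
          + (-(r * ((∑ n ∈ Finset.range (b * a), (f (x n) - c)) ^ 2 / ((b : ℝ) * (a : ℝ) ^ 2)))) ^ 2
          + ((r - 1) * σ2) ^ 2) := h4sq _ _ _ _
      _ = 4 * (r ^ 2 * ((∑ j ∈ Finset.range a, U j x) / a - EV) ^ 2 + r ^ 2 * (EV - σ2) ^ 2
          + r ^ 2 * ((∑ n ∈ Finset.range (b * a), (f (x n) - c)) ^ 2 / ((b : ℝ) * (a : ℝ) ^ 2)) ^ 2
          + (r - 1) ^ 2 * σ2 ^ 2) := by ring
      _ ≤ 4 * (4 * ((∑ j ∈ Finset.range a, U j x) / a - EV) ^ 2 + 4 * (EV - σ2) ^ 2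
          + 4 * ((∑ n ∈ Finset.range (b * a), (f (x n) - c)) ^ 2 / ((b : ℝ) * (a : ℝ) ^ 2)) ^ 2
          + 4 / (a : ℝ) ^ 2 * σmax ^ 2) := by linarith only [hX, hY, hZ, hv4]
      _ = _ := by ring
  -- integrability of the right-hand side
  have hUm : ∀ j, Measurable (U j) := fun j => (batchSq_bounded_measurable hfb hCfb b j).1
  have hUb : ∀ j x, |U j x| ≤ (b * (2 * C)) ^ 2 / b := fun j x =>
    (batchSq_bounded_measurable hfb hCfb b j).2 x
  have hVm : Measurable fun x : ℕ → Ω => (∑ j ∈ Finset.range a, U j x) / a - EV :=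
    ((Finset.measurable_sum _ fun j _ => hUm j).div_const _).sub measurable_const
  have hVb : ∀ x : ℕ → Ω, |(∑ j ∈ Finset.range a, U j x) / a - EV|
      ≤ (a * ((b * (2 * C)) ^ 2 / b)) / a + |EV| := fun x => by
    refine (abs_sub _ _).trans (add_le_add ?_ le_rfl)
    rw [abs_div, Nat.abs_cast]
    refine div_le_div_of_nonneg_right ?_ haR.le
    exact (Finset.abs_sum_le_sum_abs _ _).trans ((Finset.sum_le_sum fun j _ => hUb j x).trans
      (by rw [Finset.sum_const, Finset.card_range, nsmul_eq_mul]))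
  have hiV2 : Integrable (fun x : ℕ → Ω => ((∑ j ∈ Finset.range a, U j x) / a - EV) ^ 2) P :=
    integrable_of_bounded P (hVm.pow_const 2) (C := ((a * ((b * (2 * C)) ^ 2 / b)) / a + |EV|) ^ 2)
      fun x => by rw [abs_pow]; exact pow_le_pow_left₀ (abs_nonneg _) (hVb x) 2
  have hTm : Measurable fun x : ℕ → Ω =>
      (∑ n ∈ Finset.range (b * a), (f (x n) - c)) ^ 2 / ((b : ℝ) * (a : ℝ) ^ 2) :=
    ((Finset.measurable_sum _ fun n _ => hfb.comp (measurable_pi_apply _)).pow_const 2).div_const _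
  have hTb : ∀ x : ℕ → Ω, |(∑ n ∈ Finset.range (b * a), (f (x n) - c)) ^ 2 / ((b : ℝ) * (a : ℝ) ^ 2)|
      ≤ ((b * a : ℕ) * (2 * C)) ^ 2 / ((b : ℝ) * (a : ℝ) ^ 2) := fun x => by
    rw [abs_div, abs_pow, abs_of_pos (by positivity : (0 : ℝ) < (b : ℝ) * (a : ℝ) ^ 2)]
    refine div_le_div_of_nonneg_right (pow_le_pow_left₀ (abs_nonneg _) ?_ 2) (by positivity)
    exact (Finset.abs_sum_le_sum_abs _ _).trans ((Finset.sum_le_sum fun n _ => hCfb _).trans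
      (by rw [Finset.sum_const, Finset.card_range, nsmul_eq_mul]))
  have hiW2 : Integrable (fun x : ℕ → Ω =>
      ((∑ n ∈ Finset.range (b * a), (f (x n) - c)) ^ 2 / ((b : ℝ) * (a : ℝ) ^ 2)) ^ 2) P :=
    integrable_of_bounded P (hTm.pow_const 2)
      (C := (((b * a : ℕ) * (2 * C)) ^ 2 / ((b : ℝ) * (a : ℝ) ^ 2)) ^ 2)
      fun x => by rw [abs_pow]; exact pow_le_pow_left₀ (abs_nonneg _) (hTb x) 2
  have hiR : Integrable (fun x : ℕ → Ω =>
      16 * ((∑ j ∈ Finset.range a, U j x) / a - EV) ^ 2 + 16 * (EV - σ2) ^ 2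
        + 16 * ((∑ n ∈ Finset.range (b * a), (f (x n) - c)) ^ 2 / ((b : ℝ) * (a : ℝ) ^ 2)) ^ 2
        + 16 / (a : ℝ) ^ 2 * σmax ^ 2) P :=
    (((hiV2.const_mul 16).add (integrable_const _)).add (hiW2.const_mul 16)).add (integrable_const _)
  -- integrate
  have hI1 : Integrable (fun x : ℕ → Ω =>
      16 * ((∑ j ∈ Finset.range a, U j x) / a - EV) ^ 2 + 16 * (EV - σ2) ^ 2) P :=
    (hiV2.const_mul 16).add (integrable_const _)
  have hI2 : Integrable (fun x : ℕ → Ω =>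
      16 * ((∑ j ∈ Finset.range a, U j x) / a - EV) ^ 2 + 16 * (EV - σ2) ^ 2
        + 16 * ((∑ n ∈ Finset.range (b * a), (f (x n) - c)) ^ 2 / ((b : ℝ) * (a : ℝ) ^ 2)) ^ 2) P :=
    hI1.add (hiW2.const_mul 16)
  calc ∫ x, (((b * a : ℕ) : ℝ) * replicaSEsq (fun j (x : ℕ → Ω) =>
          (∑ i ∈ Finset.range b, f (x (b * j + i))) / b) a x - σ2) ^ 2 ∂P
      ≤ ∫ x, (16 * ((∑ j ∈ Finset.range a, U j x) / a - EV) ^ 2 + 16 * (EV - σ2) ^ 2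
          + 16 * ((∑ n ∈ Finset.range (b * a), (f (x n) - c)) ^ 2 / ((b : ℝ) * (a : ℝ) ^ 2)) ^ 2
          + 16 / (a : ℝ) ^ 2 * σmax ^ 2) ∂P := by
        refine integral_mono_of_nonneg ?_ hiR (ae_of_all _ hpt)
        exact ae_of_all _ fun x => sq_nonneg _
    _ = 16 * ∫ x, ((∑ j ∈ Finset.range a, U j x) / a - EV) ^ 2 ∂P + 16 * (EV - σ2) ^ 2
          + 16 * ∫ x, ((∑ n ∈ Finset.range (b * a), (f (x n) - c)) ^ 2 / ((b : ℝ) * (a : ℝ) ^ 2)) ^ 2 ∂P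
          + 16 / (a : ℝ) ^ 2 * σmax ^ 2 := by
        have hE1 : ∫ x, 16 * ((∑ j ∈ Finset.range a, U j x) / a - EV) ^ 2 ∂P
            = 16 * ∫ x, ((∑ j ∈ Finset.range a, U j x) / a - EV) ^ 2 ∂P := integral_const_mul _ _
        have hE2 : ∫ x, 16 * ((∑ n ∈ Finset.range (b * a), (f (x n) - c)) ^ 2
            / ((b : ℝ) * (a : ℝ) ^ 2)) ^ 2 ∂P
            = 16 * ∫ x, ((∑ n ∈ Finset.range (b * a), (f (x n) - c)) ^ 2
              / ((b : ℝ) * (a : ℝ) ^ 2)) ^ 2 ∂P := integral_const_mul _ _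
        rw [integral_add hI2 (integrable_const _), integral_add hI1 (hiW2.const_mul 16),
          integral_add (hiV2.const_mul 16) (integrable_const _), hE1, hE2,
          integral_const, integral_const, probReal_univ, smul_eq_mul, smul_eq_mul, one_mul, one_mul]
    _ ≤ 16 * ((K4 + K6) / a) + 16 * (Kb ^ 2 / (b : ℝ) ^ 2)
          + 16 * (K4 / (a : ℝ) ^ 2) + 16 / (a : ℝ) ^ 2 * σmax ^ 2 := by
        have hV' : ∫ x, ((∑ j ∈ Finset.range a, U j x) / a - EV) ^ 2 ∂P ≤ (K4 + K6) / a := by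
          refine hVar.trans (le_of_eq ?_)
          rw [hK4, hK6, hθ]
        linarith only [hV', hbias2, hW]
    _ ≤ (32 * K4 + 16 * K6 + 16 * σmax ^ 2) / a + 16 * Kb ^ 2 / (b : ℝ) ^ 2 := by
        have hK40 : 0 ≤ K4 := by positivity
        have hs0 : 0 ≤ σmax ^ 2 := sq_nonneg _
        have ha1' : (1 : ℝ) ≤ a := by linarith only [ha2]
        have h1 : K4 / (a : ℝ) ^ 2 ≤ K4 / a :=
          div_le_div_of_nonneg_left hK40 haR (by nlinarith only [ha1'])
        have h2 : 16 / (a : ℝ) ^ 2 * σmax ^ 2 ≤ 16 * σmax ^ 2 / a := by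
          rw [div_mul_eq_mul_div]
          exact div_le_div_of_nonneg_left (by positivity) haR (by nlinarith only [ha1'])
        have hsplit : (32 * K4 + 16 * K6 + 16 * σmax ^ 2) / (a : ℝ)
            = 16 * ((K4 + K6) / a) + 16 * (K4 / a) + 16 * σmax ^ 2 / a := by
          field_simp; ring
        have hsplit' : 16 * Kb ^ 2 / (b : ℝ) ^ 2 = 16 * (Kb ^ 2 / (b : ℝ) ^ 2) := by ring
        rw [hsplit, hsplit']
        linarith only [h1, h2]


end Envelope

/-! ### Under a Doeblin power -/

section Power

variable {κ : Kernel Ω Ω} [IsMarkovKernel κ] {ν : Measure Ω} [IsProbabilityMeasure ν] {ε : ℝ≥0∞}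
  {π : Measure Ω} [IsProbabilityMeasure π] {m : ℕ}

/-- **`O(1/a + 1/b²)` MEAN-SQUARE ERROR OF THE BATCH-MEANS ESTIMATOR UNDER A DOEBLIN POWER, FROM
ANY START.**  `π` invariant, `(nHit κ m)(x, ·) ≥ ε ν` (`0 < ε ≤ 1`, `0 < m`), `|f| ≤ C` measurable:
`∃ K K'', ∀ μ₀, ∀ a ≥ 2, ∀ b ≥ 1, E_{μ₀}[(ab · SE²_BM − σ²_f)²] ≤ K/a + K''/b²`. -/
theorem chain_batchMeans_sigmaHat_mse_le_rate_of_nHit (hπ : Kernel.Invariant κ π)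
    (hmin : ∀ x {B : Set Ω}, MeasurableSet B → ε * ν B ≤ Exactness.nHit κ m x B) (hε0 : 0 < ε)
    (hε1 : ε ≤ 1) (hm : 0 < m) {f : Ω → ℝ} (hf : Measurable f) {C : ℝ} (hC : ∀ x, |f x| ≤ C) :
    ∃ K K'' : ℝ, ∀ (μ₀ : Measure Ω) [IsProbabilityMeasure μ₀] (a b : ℕ), 2 ≤ a → b ≠ 0 →
      ∫ x, (((b * a : ℕ) : ℝ)
          * replicaSEsq (fun j (x : ℕ → Ω) => (∑ i ∈ Finset.range b, f (x (b * j + i))) / b) a x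
          - ((∫ y, (f y - ∫ z, f z ∂π) ^ 2 ∂π)
            + 2 * ∑' k, ∫ y, (f y - ∫ z, f z ∂π)
              * (kop κ)^[k + 1] (fun y => f y - ∫ z, f z ∂π) y ∂π)) ^ 2
        ∂(Kernel.trajMeasure (X := fun _ : ℕ => Ω) μ₀
          (fun n : ℕ => κ.comap (fun h : (i : ↥(Finset.Iic n)) → Ω => h ⟨n, Finset.mem_Iic.2 le_rfl⟩)
            (measurable_pi_apply _)))
        ≤ K / a + K'' / (b : ℝ) ^ 2 := by
  obtain ⟨A, ρ, hA, hρ0, hρ1, henv⟩ := exists_geometricEnvelope_of_nHit hmin hε0 hε1 hm hπ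
  exact chain_batchMeans_sigmaHat_mse_le_rate_of_envelope hπ henv hA hρ0 hρ1 hf hC

end Power

end Summit.Ventures.LatticeQCDFlow.Scoring

end
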